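import Summits.Ventures.PercRepro.C041TriangleMixedFamily

/-!
# THE THREE-EXIT CYCLE BY ARC TYPES — the model, its reduction to the SQUARE MAP, and the cone form
(mine-3, gen 60; C-041.md §21 (ah))

The cycle `a – x₁ – x₂ – x₃ – a` through the anchor with three exits carrying the zones `w₁, w₂, w₃`, by the types of its
four arcs (`Arc`: all blue / all red / mixed, a mixed arc of length `ℓ` counted `2^ℓ − 2` times): `sqCol` lists the 81
cases by the status rules of C-041.md §20 (c)–(d) (merged / reached exits, blue sub-zones of separated exits with their
joint vectors), `thetaSq p₁ p₂ p₃ p₄ w₁ w₂ w₃` is the weighted sum, `square w₁ w₂ w₃` = the 16 pure colourings (the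
«square map» Θ_□ of §21 (x), validated there against the brute-force enumerator on 83 / 83 real 4-cycles).
**THEOREM (`thetaSq_eq`)**: the three-exit cycle reduces to the square map plus sixteen TREE terms (every mixed arc cuts
the cycle into paths hanging at the anchor, or cuts off a blue sub-zone): an exact identity of six-vectors.  Hence
(`InCone_thetaSq_of_InCone_sq`) a three-exit cycle with cone-member zones is in the cone as soon as its square part is —
and (P), (CS), the O-cube follow (`K4v_thetaSq_of_InCone_sq`).  The square map is symmetric under the reflection
`x₁ ↔ x₃` (`square_comm`), and with an UNMARKED exit it IS the two-exit cycle of `C041CycleArcModel` with a doubled arc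
(`square_one_left / _mid / _right`), so every three-exit cycle one of whose zones is `1` and whose other two are marked
vertices lies in the cone by `InCone_thetaTri_marks`.  The dictionary «`thetaSq` is the cycle's six-vector» stays
paper-level (§21 (x)), exactly as for `thetaCyc`.
-/

namespace PercRepro

namespace RelaxedTriangle

open TreeClosure

/-! ## The three-exit cycle by arc types -/

/-- The admissible-count coordinates `(L₀, L₁, L₂)` of a zone. -/
def lo (w : Vec6) : Fin 3 → ℝ := ![w 0, w 1, w 2]

/-- The invalid-count coordinates `(M₀, M₁, M₂)` of a zone. -/
def hi (w : Vec6) : Fin 3 → ℝ := ![w 3, w 4, w 5]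

/-- The joint count of a two-exit blue sub-zone: `x₁y₁ + x₂y₂ − x₀y₀` (`lo` for an unreached exit, `hi` for a reached one
in the invalid count). -/
def jv2 (x y : Fin 3 → ℝ) : ℝ := x 1 * y 1 + x 2 * y 2 - x 0 * y 0

/-- The joint count of a three-exit blue sub-zone. -/
def jv3 (x y z : Fin 3 → ℝ) : ℝ := x 1 * y 1 * z 1 + x 2 * y 2 * z 2 - x 0 * y 0 * z 0

/-- The contribution of the three hanging zones for one quadruple of arc types `(A₁, A₂, A₃, A₄)` of the cycle
`a – x₁ – x₂ – x₃ – a` (C-041.md §20 (c)–(d), §21 (x)): merged exits contribute `thB` (unreached) or the zone itself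
(reached); separated exits fall into blue sub-zones (`x₁x₂` joined by a blue `A₂`, `x₂x₃` by a blue `A₃`), each
contributing its joint vector. -/
def sqCol (w₁ w₂ w₃ : Vec6) : Arc → Arc → Arc → Arc → Vec6
  | .b, .b, .b, .b => thB w₁ * thB w₂ * thB w₃
  | .b, .b, .b, .r => thB w₁ * thB w₂ * w₃
  | .b, .b, .b, .x => thB w₁ * thB w₂ * thB w₃
  | .b, .b, .r, .b => thB w₁ * thB w₂ * thB w₃
  | .b, .b, .r, .r => thB w₁ * w₂ * thR w₃
  | .b, .b, .r, .x => thB w₁ * thB w₂ * nAdm w₃ • (1 : Vec6)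
  | .b, .b, .x, .b => thB w₁ * thB w₂ * thB w₃
  | .b, .b, .x, .r => thB w₁ * thB w₂ * thR w₃
  | .b, .b, .x, .x => thB w₁ * thB w₂ * nAdm w₃ • (1 : Vec6)
  | .b, .r, .b, .b => thB w₁ * thB w₂ * thB w₃
  | .b, .r, .b, .r => thB w₁ * jointVec (jv2 (lo w₂) (lo w₃)) (jv2 (lo w₂) (hi w₃))
  | .b, .r, .b, .x => thB w₁ * jointVec (jv2 (lo w₂) (lo w₃)) (jv2 (lo w₂) (lo w₃))
  | .b, .r, .r, .b => thB w₁ * thB w₃ * nAdm w₂ • (1 : Vec6)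
  | .b, .r, .r, .r => w₁ * thR w₂ * thR w₃
  | .b, .r, .r, .x => thB w₁ * nAdm w₂ • (1 : Vec6) * nAdm w₃ • (1 : Vec6)
  | .b, .r, .x, .b => thB w₁ * thB w₃ * nAdm w₂ • (1 : Vec6)
  | .b, .r, .x, .r => thB w₁ * nAdm w₂ • (1 : Vec6) * thR w₃
  | .b, .r, .x, .x => thB w₁ * nAdm w₂ • (1 : Vec6) * nAdm w₃ • (1 : Vec6)
  | .b, .x, .b, .b => thB w₁ * thB w₂ * thB w₃
  | .b, .x, .b, .r => thB w₁ * jointVec (jv2 (lo w₂) (lo w₃)) (jv2 (lo w₂) (hi w₃))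
  | .b, .x, .b, .x => thB w₁ * jointVec (jv2 (lo w₂) (lo w₃)) (jv2 (lo w₂) (lo w₃))
  | .b, .x, .r, .b => thB w₁ * thB w₃ * nAdm w₂ • (1 : Vec6)
  | .b, .x, .r, .r => thB w₁ * thR w₂ * thR w₃
  | .b, .x, .r, .x => thB w₁ * nAdm w₂ • (1 : Vec6) * nAdm w₃ • (1 : Vec6)
  | .b, .x, .x, .b => thB w₁ * thB w₃ * nAdm w₂ • (1 : Vec6)
  | .b, .x, .x, .r => thB w₁ * nAdm w₂ • (1 : Vec6) * thR w₃
  | .b, .x, .x, .x => thB w₁ * nAdm w₂ • (1 : Vec6) * nAdm w₃ • (1 : Vec6)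
  | .r, .b, .b, .b => w₁ * thB w₂ * thB w₃
  | .r, .b, .b, .r => jointVec (jv3 (lo w₁) (lo w₂) (lo w₃)) (jv3 (hi w₁) (lo w₂) (hi w₃))
  | .r, .b, .b, .x => jointVec (jv3 (lo w₁) (lo w₂) (lo w₃)) (jv3 (hi w₁) (lo w₂) (lo w₃))
  | .r, .b, .r, .b => thB w₃ * jointVec (jv2 (lo w₁) (lo w₂)) (jv2 (hi w₁) (lo w₂))
  | .r, .b, .r, .r => jointVec (jv2 (lo w₁) (lo w₂)) (jv2 (hi w₁) (hi w₂)) * thR w₃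
  | .r, .b, .r, .x => jointVec (jv2 (lo w₁) (lo w₂)) (jv2 (hi w₁) (lo w₂)) * nAdm w₃ • (1 : Vec6)
  | .r, .b, .x, .b => thB w₃ * jointVec (jv2 (lo w₁) (lo w₂)) (jv2 (hi w₁) (lo w₂))
  | .r, .b, .x, .r => jointVec (jv2 (lo w₁) (lo w₂)) (jv2 (hi w₁) (lo w₂)) * thR w₃
  | .r, .b, .x, .x => jointVec (jv2 (lo w₁) (lo w₂)) (jv2 (hi w₁) (lo w₂)) * nAdm w₃ • (1 : Vec6)
  | .r, .r, .b, .b => w₂ * thB w₃ * thR w₁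
  | .r, .r, .b, .r => thR w₁ * jointVec (jv2 (lo w₂) (lo w₃)) (jv2 (hi w₂) (hi w₃))
  | .r, .r, .b, .x => thR w₁ * jointVec (jv2 (lo w₂) (lo w₃)) (jv2 (hi w₂) (lo w₃))
  | .r, .r, .r, .b => w₃ * thR w₁ * thR w₂
  | .r, .r, .r, .r => thR w₁ * thR w₂ * thR w₃
  | .r, .r, .r, .x => thR w₁ * thR w₂ * thR w₃
  | .r, .r, .x, .b => thB w₃ * thR w₁ * thR w₂
  | .r, .r, .x, .r => thR w₁ * thR w₂ * thR w₃
  | .r, .r, .x, .x => thR w₁ * thR w₂ * nAdm w₃ • (1 : Vec6)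
  | .r, .x, .b, .b => thB w₂ * thB w₃ * thR w₁
  | .r, .x, .b, .r => thR w₁ * jointVec (jv2 (lo w₂) (lo w₃)) (jv2 (lo w₂) (hi w₃))
  | .r, .x, .b, .x => thR w₁ * jointVec (jv2 (lo w₂) (lo w₃)) (jv2 (lo w₂) (lo w₃))
  | .r, .x, .r, .b => thB w₃ * thR w₁ * nAdm w₂ • (1 : Vec6)
  | .r, .x, .r, .r => thR w₁ * thR w₂ * thR w₃
  | .r, .x, .r, .x => thR w₁ * nAdm w₂ • (1 : Vec6) * nAdm w₃ • (1 : Vec6)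
  | .r, .x, .x, .b => thB w₃ * thR w₁ * nAdm w₂ • (1 : Vec6)
  | .r, .x, .x, .r => thR w₁ * nAdm w₂ • (1 : Vec6) * thR w₃
  | .r, .x, .x, .x => thR w₁ * nAdm w₂ • (1 : Vec6) * nAdm w₃ • (1 : Vec6)
  | .x, .b, .b, .b => thB w₁ * thB w₂ * thB w₃
  | .x, .b, .b, .r => jointVec (jv3 (lo w₁) (lo w₂) (lo w₃)) (jv3 (lo w₁) (lo w₂) (hi w₃))
  | .x, .b, .b, .x => jointVec (jv3 (lo w₁) (lo w₂) (lo w₃)) (jv3 (lo w₁) (lo w₂) (lo w₃))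
  | .x, .b, .r, .b => thB w₃ * jointVec (jv2 (lo w₁) (lo w₂)) (jv2 (lo w₁) (lo w₂))
  | .x, .b, .r, .r => jointVec (jv2 (lo w₁) (lo w₂)) (jv2 (lo w₁) (hi w₂)) * thR w₃
  | .x, .b, .r, .x => jointVec (jv2 (lo w₁) (lo w₂)) (jv2 (lo w₁) (lo w₂)) * nAdm w₃ • (1 : Vec6)
  | .x, .b, .x, .b => thB w₃ * jointVec (jv2 (lo w₁) (lo w₂)) (jv2 (lo w₁) (lo w₂))
  | .x, .b, .x, .r => jointVec (jv2 (lo w₁) (lo w₂)) (jv2 (lo w₁) (lo w₂)) * thR w₃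
  | .x, .b, .x, .x => jointVec (jv2 (lo w₁) (lo w₂)) (jv2 (lo w₁) (lo w₂)) * nAdm w₃ • (1 : Vec6)
  | .x, .r, .b, .b => thB w₂ * thB w₃ * nAdm w₁ • (1 : Vec6)
  | .x, .r, .b, .r => nAdm w₁ • (1 : Vec6) * jointVec (jv2 (lo w₂) (lo w₃)) (jv2 (lo w₂) (hi w₃))
  | .x, .r, .b, .x => nAdm w₁ • (1 : Vec6) * jointVec (jv2 (lo w₂) (lo w₃)) (jv2 (lo w₂) (lo w₃))
  | .x, .r, .r, .b => thB w₃ * nAdm w₁ • (1 : Vec6) * nAdm w₂ • (1 : Vec6)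
  | .x, .r, .r, .r => thR w₁ * thR w₂ * thR w₃
  | .x, .r, .r, .x => nAdm w₁ • (1 : Vec6) * nAdm w₂ • (1 : Vec6) * nAdm w₃ • (1 : Vec6)
  | .x, .r, .x, .b => thB w₃ * nAdm w₁ • (1 : Vec6) * nAdm w₂ • (1 : Vec6)
  | .x, .r, .x, .r => nAdm w₁ • (1 : Vec6) * nAdm w₂ • (1 : Vec6) * thR w₃
  | .x, .r, .x, .x => nAdm w₁ • (1 : Vec6) * nAdm w₂ • (1 : Vec6) * nAdm w₃ • (1 : Vec6)
  | .x, .x, .b, .b => thB w₂ * thB w₃ * nAdm w₁ • (1 : Vec6)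
  | .x, .x, .b, .r => nAdm w₁ • (1 : Vec6) * jointVec (jv2 (lo w₂) (lo w₃)) (jv2 (lo w₂) (hi w₃))
  | .x, .x, .b, .x => nAdm w₁ • (1 : Vec6) * jointVec (jv2 (lo w₂) (lo w₃)) (jv2 (lo w₂) (lo w₃))
  | .x, .x, .r, .b => thB w₃ * nAdm w₁ • (1 : Vec6) * nAdm w₂ • (1 : Vec6)
  | .x, .x, .r, .r => nAdm w₁ • (1 : Vec6) * thR w₂ * thR w₃
  | .x, .x, .r, .x => nAdm w₁ • (1 : Vec6) * nAdm w₂ • (1 : Vec6) * nAdm w₃ • (1 : Vec6)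
  | .x, .x, .x, .b => thB w₃ * nAdm w₁ • (1 : Vec6) * nAdm w₂ • (1 : Vec6)
  | .x, .x, .x, .r => nAdm w₁ • (1 : Vec6) * nAdm w₂ • (1 : Vec6) * thR w₃
  | .x, .x, .x, .x => nAdm w₁ • (1 : Vec6) * nAdm w₂ • (1 : Vec6) * nAdm w₃ • (1 : Vec6)

/-- One weighted term of the three-exit cycle map. -/
def sqTerm (p₁ p₂ p₃ p₄ : ℝ) (w₁ w₂ w₃ : Vec6) (a1 a2 a3 a4 : Arc) : Vec6 :=
  (multArc p₁ a1 * multArc p₂ a2 * multArc p₃ a3 * multArc p₄ a4) • sqCol w₁ w₂ w₃ a1 a2 a3 a4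

/-- **The three-exit cycle map** `Θ_{C}(w₁, w₂, w₃)` with mixed-arc multiplicities `p₁, p₂, p₃, p₄`: the sum over the
81 arc-type quadruples. -/
def thetaSq (p₁ p₂ p₃ p₄ : ℝ) (w₁ w₂ w₃ : Vec6) : Vec6 :=
    sqTerm p₁ p₂ p₃ p₄ w₁ w₂ w₃ .b .b .b .b
    + sqTerm p₁ p₂ p₃ p₄ w₁ w₂ w₃ .b .b .b .r
    + sqTerm p₁ p₂ p₃ p₄ w₁ w₂ w₃ .b .b .b .x
    + sqTerm p₁ p₂ p₃ p₄ w₁ w₂ w₃ .b .b .r .b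
    + sqTerm p₁ p₂ p₃ p₄ w₁ w₂ w₃ .b .b .r .r
    + sqTerm p₁ p₂ p₃ p₄ w₁ w₂ w₃ .b .b .r .x
    + sqTerm p₁ p₂ p₃ p₄ w₁ w₂ w₃ .b .b .x .b
    + sqTerm p₁ p₂ p₃ p₄ w₁ w₂ w₃ .b .b .x .r
    + sqTerm p₁ p₂ p₃ p₄ w₁ w₂ w₃ .b .b .x .x
    + sqTerm p₁ p₂ p₃ p₄ w₁ w₂ w₃ .b .r .b .b
    + sqTerm p₁ p₂ p₃ p₄ w₁ w₂ w₃ .b .r .b .r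
    + sqTerm p₁ p₂ p₃ p₄ w₁ w₂ w₃ .b .r .b .x
    + sqTerm p₁ p₂ p₃ p₄ w₁ w₂ w₃ .b .r .r .b
    + sqTerm p₁ p₂ p₃ p₄ w₁ w₂ w₃ .b .r .r .r
    + sqTerm p₁ p₂ p₃ p₄ w₁ w₂ w₃ .b .r .r .x
    + sqTerm p₁ p₂ p₃ p₄ w₁ w₂ w₃ .b .r .x .b
    + sqTerm p₁ p₂ p₃ p₄ w₁ w₂ w₃ .b .r .x .r
    + sqTerm p₁ p₂ p₃ p₄ w₁ w₂ w₃ .b .r .x .x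
    + sqTerm p₁ p₂ p₃ p₄ w₁ w₂ w₃ .b .x .b .b
    + sqTerm p₁ p₂ p₃ p₄ w₁ w₂ w₃ .b .x .b .r
    + sqTerm p₁ p₂ p₃ p₄ w₁ w₂ w₃ .b .x .b .x
    + sqTerm p₁ p₂ p₃ p₄ w₁ w₂ w₃ .b .x .r .b
    + sqTerm p₁ p₂ p₃ p₄ w₁ w₂ w₃ .b .x .r .r
    + sqTerm p₁ p₂ p₃ p₄ w₁ w₂ w₃ .b .x .r .x
    + sqTerm p₁ p₂ p₃ p₄ w₁ w₂ w₃ .b .x .x .b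
    + sqTerm p₁ p₂ p₃ p₄ w₁ w₂ w₃ .b .x .x .r
    + sqTerm p₁ p₂ p₃ p₄ w₁ w₂ w₃ .b .x .x .x
    + sqTerm p₁ p₂ p₃ p₄ w₁ w₂ w₃ .r .b .b .b
    + sqTerm p₁ p₂ p₃ p₄ w₁ w₂ w₃ .r .b .b .r
    + sqTerm p₁ p₂ p₃ p₄ w₁ w₂ w₃ .r .b .b .x
    + sqTerm p₁ p₂ p₃ p₄ w₁ w₂ w₃ .r .b .r .b
    + sqTerm p₁ p₂ p₃ p₄ w₁ w₂ w₃ .r .b .r .r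
    + sqTerm p₁ p₂ p₃ p₄ w₁ w₂ w₃ .r .b .r .x
    + sqTerm p₁ p₂ p₃ p₄ w₁ w₂ w₃ .r .b .x .b
    + sqTerm p₁ p₂ p₃ p₄ w₁ w₂ w₃ .r .b .x .r
    + sqTerm p₁ p₂ p₃ p₄ w₁ w₂ w₃ .r .b .x .x
    + sqTerm p₁ p₂ p₃ p₄ w₁ w₂ w₃ .r .r .b .b
    + sqTerm p₁ p₂ p₃ p₄ w₁ w₂ w₃ .r .r .b .r
    + sqTerm p₁ p₂ p₃ p₄ w₁ w₂ w₃ .r .r .b .x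
    + sqTerm p₁ p₂ p₃ p₄ w₁ w₂ w₃ .r .r .r .b
    + sqTerm p₁ p₂ p₃ p₄ w₁ w₂ w₃ .r .r .r .r
    + sqTerm p₁ p₂ p₃ p₄ w₁ w₂ w₃ .r .r .r .x
    + sqTerm p₁ p₂ p₃ p₄ w₁ w₂ w₃ .r .r .x .b
    + sqTerm p₁ p₂ p₃ p₄ w₁ w₂ w₃ .r .r .x .r
    + sqTerm p₁ p₂ p₃ p₄ w₁ w₂ w₃ .r .r .x .x
    + sqTerm p₁ p₂ p₃ p₄ w₁ w₂ w₃ .r .x .b .b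
    + sqTerm p₁ p₂ p₃ p₄ w₁ w₂ w₃ .r .x .b .r
    + sqTerm p₁ p₂ p₃ p₄ w₁ w₂ w₃ .r .x .b .x
    + sqTerm p₁ p₂ p₃ p₄ w₁ w₂ w₃ .r .x .r .b
    + sqTerm p₁ p₂ p₃ p₄ w₁ w₂ w₃ .r .x .r .r
    + sqTerm p₁ p₂ p₃ p₄ w₁ w₂ w₃ .r .x .r .x
    + sqTerm p₁ p₂ p₃ p₄ w₁ w₂ w₃ .r .x .x .b
    + sqTerm p₁ p₂ p₃ p₄ w₁ w₂ w₃ .r .x .x .r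
    + sqTerm p₁ p₂ p₃ p₄ w₁ w₂ w₃ .r .x .x .x
    + sqTerm p₁ p₂ p₃ p₄ w₁ w₂ w₃ .x .b .b .b
    + sqTerm p₁ p₂ p₃ p₄ w₁ w₂ w₃ .x .b .b .r
    + sqTerm p₁ p₂ p₃ p₄ w₁ w₂ w₃ .x .b .b .x
    + sqTerm p₁ p₂ p₃ p₄ w₁ w₂ w₃ .x .b .r .b
    + sqTerm p₁ p₂ p₃ p₄ w₁ w₂ w₃ .x .b .r .r
    + sqTerm p₁ p₂ p₃ p₄ w₁ w₂ w₃ .x .b .r .x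
    + sqTerm p₁ p₂ p₃ p₄ w₁ w₂ w₃ .x .b .x .b
    + sqTerm p₁ p₂ p₃ p₄ w₁ w₂ w₃ .x .b .x .r
    + sqTerm p₁ p₂ p₃ p₄ w₁ w₂ w₃ .x .b .x .x
    + sqTerm p₁ p₂ p₃ p₄ w₁ w₂ w₃ .x .r .b .b
    + sqTerm p₁ p₂ p₃ p₄ w₁ w₂ w₃ .x .r .b .r
    + sqTerm p₁ p₂ p₃ p₄ w₁ w₂ w₃ .x .r .b .x
    + sqTerm p₁ p₂ p₃ p₄ w₁ w₂ w₃ .x .r .r .b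
    + sqTerm p₁ p₂ p₃ p₄ w₁ w₂ w₃ .x .r .r .r
    + sqTerm p₁ p₂ p₃ p₄ w₁ w₂ w₃ .x .r .r .x
    + sqTerm p₁ p₂ p₃ p₄ w₁ w₂ w₃ .x .r .x .b
    + sqTerm p₁ p₂ p₃ p₄ w₁ w₂ w₃ .x .r .x .r
    + sqTerm p₁ p₂ p₃ p₄ w₁ w₂ w₃ .x .r .x .x
    + sqTerm p₁ p₂ p₃ p₄ w₁ w₂ w₃ .x .x .b .b
    + sqTerm p₁ p₂ p₃ p₄ w₁ w₂ w₃ .x .x .b .r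
    + sqTerm p₁ p₂ p₃ p₄ w₁ w₂ w₃ .x .x .b .x
    + sqTerm p₁ p₂ p₃ p₄ w₁ w₂ w₃ .x .x .r .b
    + sqTerm p₁ p₂ p₃ p₄ w₁ w₂ w₃ .x .x .r .r
    + sqTerm p₁ p₂ p₃ p₄ w₁ w₂ w₃ .x .x .r .x
    + sqTerm p₁ p₂ p₃ p₄ w₁ w₂ w₃ .x .x .x .b
    + sqTerm p₁ p₂ p₃ p₄ w₁ w₂ w₃ .x .x .x .r
    + sqTerm p₁ p₂ p₃ p₄ w₁ w₂ w₃ .x .x .x .x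

/-- **The square map** `Θ_□(w₁, w₂, w₃)`: the 16 pure colourings (C-041.md §21 (x)). -/
def square (w₁ w₂ w₃ : Vec6) : Vec6 :=
    sqCol w₁ w₂ w₃ .b .b .b .b
    + sqCol w₁ w₂ w₃ .b .b .b .r
    + sqCol w₁ w₂ w₃ .b .b .r .b
    + sqCol w₁ w₂ w₃ .b .b .r .r
    + sqCol w₁ w₂ w₃ .b .r .b .b
    + sqCol w₁ w₂ w₃ .b .r .b .r
    + sqCol w₁ w₂ w₃ .b .r .r .b
    + sqCol w₁ w₂ w₃ .b .r .r .r
    + sqCol w₁ w₂ w₃ .r .b .b .b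
    + sqCol w₁ w₂ w₃ .r .b .b .r
    + sqCol w₁ w₂ w₃ .r .b .r .b
    + sqCol w₁ w₂ w₃ .r .b .r .r
    + sqCol w₁ w₂ w₃ .r .r .b .b
    + sqCol w₁ w₂ w₃ .r .r .b .r
    + sqCol w₁ w₂ w₃ .r .r .r .b
    + sqCol w₁ w₂ w₃ .r .r .r .r

/-- **THE THREE-EXIT CYCLE REDUCES TO THE SQUARE MAP** (C-041.md §21 (ah)): every mixed arc cuts the cycle into trees
hanging at the anchor (nested `ℓψ`), or cuts off a blue sub-zone (a multiple of `1`); exact. -/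
theorem thetaSq_eq (p₁ p₂ p₃ p₄ : ℝ) (w₁ w₂ w₃ : Vec6) :
    thetaSq p₁ p₂ p₃ p₄ w₁ w₂ w₃ = square w₁ w₂ w₃
      + p₁ • ellv (w₃ * ellv (w₂ * ellv w₁))
      + p₄ • ellv (w₁ * ellv (w₂ * ellv w₃))
      + p₂ • (ellv w₁ * ellv (w₃ * ellv w₂))
      + p₃ • (ellv w₃ * ellv (w₁ * ellv w₂))
      + (p₁ * p₂ * nAdm w₁) • ellv (w₃ * ellv w₂)
      + (p₃ * p₄ * nAdm w₃) • ellv (w₁ * ellv w₂)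
      + (p₁ * p₃ * (nAdm (w₁ * w₂) + nAdm w₁ * nAdm w₂)) • ellv w₃
      + (p₂ * p₄ * (nAdm (w₂ * w₃) + nAdm w₂ * nAdm w₃)) • ellv w₁
      + (p₁ * p₄ * (nAdm (w₁ * w₂ * w₃) + nAdm (w₁ * w₂) * nAdm w₃ + nAdm w₁ * nAdm (w₂ * w₃)
          + nAdm w₁ * nAdm w₂ * nAdm w₃)) • (1 : Vec6)
      + (p₂ * p₃ * nAdm w₂) • (ellv w₁ * ellv w₃)
      + (p₁ * p₂ * p₃ * (nAdm w₁ * nAdm w₂)) • ellv w₃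
      + (p₁ * p₂ * p₄ * (nAdm w₁ * (nAdm (w₂ * w₃) + nAdm w₂ * nAdm w₃))) • (1 : Vec6)
      + (p₁ * p₃ * p₄ * (nAdm w₃ * (nAdm (w₁ * w₂) + nAdm w₁ * nAdm w₂))) • (1 : Vec6)
      + (p₂ * p₃ * p₄ * (nAdm w₂ * nAdm w₃)) • ellv w₁
      + (p₁ * p₂ * p₃ * p₄ * (nAdm w₁ * nAdm w₂ * nAdm w₃)) • (1 : Vec6) := by
  ext i
  simp only [thetaSq, sqTerm, sqCol, multArc, square, jointVec, jv2, jv3, lo, hi, Pi.add_apply, Pi.mul_apply,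
    Pi.smul_apply, Pi.one_apply, smul_eq_mul, thB, thR, ellv, ell, nAdm, kInv]
  fin_cases i <;> simp <;> ring

/-- **A three-exit cycle is in the cone if its square part is**: for cone members `w₁, w₂, w₃` with
`square w₁ w₂ w₃ ∈ cone` and multiplicities `p₁, …, p₄ ≥ 0`, `thetaSq p₁ p₂ p₃ p₄ w₁ w₂ w₃ ∈ cone`. -/
theorem InCone_thetaSq_of_InCone_sq {w₁ w₂ w₃ : Vec6} (h₁ : InCone w₁) (h₂ : InCone w₂) (h₃ : InCone w₃)
    (hsq : InCone (square w₁ w₂ w₃)) {p₁ p₂ p₃ p₄ : ℝ} (hp₁ : 0 ≤ p₁) (hp₂ : 0 ≤ p₂) (hp₃ : 0 ≤ p₃)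
    (hp₄ : 0 ≤ p₄) : InCone (thetaSq p₁ p₂ p₃ p₄ w₁ w₂ w₃) := by
  rw [thetaSq_eq]
  have n1 : 0 ≤ nAdm w₁ := nAdm_nonneg_of_K4v (K4v_of_InCone h₁)
  have n2 : 0 ≤ nAdm w₂ := nAdm_nonneg_of_K4v (K4v_of_InCone h₂)
  have n3 : 0 ≤ nAdm w₃ := nAdm_nonneg_of_K4v (K4v_of_InCone h₃)
  have n12 : 0 ≤ nAdm (w₁ * w₂) := nAdm_nonneg_of_K4v (K4v_of_InCone (h₁.mul h₂))
  have n23 : 0 ≤ nAdm (w₂ * w₃) := nAdm_nonneg_of_K4v (K4v_of_InCone (h₂.mul h₃))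
  have n123 : 0 ≤ nAdm (w₁ * w₂ * w₃) := nAdm_nonneg_of_K4v (K4v_of_InCone ((h₁.mul h₂).mul h₃))
  have e1 := InCone_ellv h₁
  have e2 := InCone_ellv h₂
  have e3 := InCone_ellv h₃
  exact (((((((((((((((hsq).add
    (InCone.smul _ hp₁ (InCone_ellv (h₃.mul (InCone_ellv (h₂.mul e1)))))).add
    (InCone.smul _ hp₄ (InCone_ellv (h₁.mul (InCone_ellv (h₂.mul e3)))))).add
    (InCone.smul _ hp₂ (e1.mul (InCone_ellv (h₃.mul e2))))).add
    (InCone.smul _ hp₃ (e3.mul (InCone_ellv (h₁.mul e2))))).add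
    (InCone.smul _ (by positivity) (InCone_ellv (h₃.mul e2)))).add
    (InCone.smul _ (by positivity) (InCone_ellv (h₁.mul e2)))).add
    (InCone.smul _ (by positivity) e3)).add
    (InCone.smul _ (by positivity) e1)).add
    (InCone.smul _ (by positivity) InCone_one)).add
    (InCone.smul _ (by positivity) (e1.mul e3))).add
    (InCone.smul _ (by positivity) e3)).add
    (InCone.smul _ (by positivity) InCone_one)).add
    (InCone.smul _ (by positivity) InCone_one)).add
    (InCone.smul _ (by positivity) e1)).add
    (InCone.smul _ (by positivity) InCone_one)

/-- (P) at the three-exit cycle whose square part is in the cone (so the one-anchor (CS) and the ZONE O-cube). -/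
theorem K4v_thetaSq_of_InCone_sq {w₁ w₂ w₃ : Vec6} (h₁ : InCone w₁) (h₂ : InCone w₂) (h₃ : InCone w₃)
    (hsq : InCone (square w₁ w₂ w₃)) {p₁ p₂ p₃ p₄ : ℝ} (hp₁ : 0 ≤ p₁) (hp₂ : 0 ≤ p₂) (hp₃ : 0 ≤ p₃)
    (hp₄ : 0 ≤ p₄) : K4v (thetaSq p₁ p₂ p₃ p₄ w₁ w₂ w₃) :=
  K4v_of_InCone (InCone_thetaSq_of_InCone_sq h₁ h₂ h₃ hsq hp₁ hp₂ hp₃ hp₄)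

/-! ## Symmetries and the unmarked exit -/

/-- The square map is symmetric under the reflection `x₁ ↔ x₃`. -/
theorem square_comm (w₁ w₂ w₃ : Vec6) : square w₁ w₂ w₃ = square w₃ w₂ w₁ := by
  ext i
  simp only [square, sqCol, jointVec, jv2, jv3, lo, hi, Pi.add_apply, Pi.mul_apply, Pi.smul_apply, Pi.one_apply,
    smul_eq_mul, thB, thR, nAdm, kInv]
  fin_cases i <;> simp <;> ring

/-- With the middle exit unmarked the square map is the two-exit cycle with a middle arc of length 2. -/
theorem square_one_mid (w₁ w₃ : Vec6) : square w₁ 1 w₃ = thetaCyc 0 2 0 w₁ w₃ := by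
  rw [thetaCyc_eq]
  ext i
  simp only [square, sqCol, jointVec, jv2, jv3, lo, hi, Pi.add_apply, Pi.mul_apply, Pi.smul_apply, Pi.one_apply,
    smul_eq_mul, thB, thR, nAdm, kInv, thetaTri_eq_vec, ellv, ell]
  fin_cases i <;> simp <;> ring

/-- With the first exit unmarked the square map is the two-exit cycle with a first arc of length 2. -/
theorem square_one_left (w₂ w₃ : Vec6) : square 1 w₂ w₃ = thetaCyc 2 0 0 w₂ w₃ := by
  rw [thetaCyc_eq]
  ext i
  simp only [square, sqCol, jointVec, jv2, jv3, lo, hi, Pi.add_apply, Pi.mul_apply, Pi.smul_apply, Pi.one_apply,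
    smul_eq_mul, thB, thR, nAdm, kInv, thetaTri_eq_vec, ellv, ell]
  fin_cases i <;> simp <;> ring

/-- With the last exit unmarked the square map is the two-exit cycle with a last arc of length 2. -/
theorem square_one_right (w₁ w₂ : Vec6) : square w₁ w₂ 1 = thetaCyc 0 0 2 w₁ w₂ := by
  rw [thetaCyc_eq]
  ext i
  simp only [square, sqCol, jointVec, jv2, jv3, lo, hi, Pi.add_apply, Pi.mul_apply, Pi.smul_apply, Pi.one_apply,
    smul_eq_mul, thB, thR, nAdm, kInv, thetaTri_eq_vec, ellv, ell]
  fin_cases i <;> simp <;> ring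

/-- The square with an unmarked middle exit and two cone members whose triangle is in the cone. -/
theorem InCone_square_one_mid {w₁ w₃ : Vec6} (h₁ : InCone w₁) (h₃ : InCone w₃) (ht : InCone (thetaTri w₁ w₃)) :
    InCone (square w₁ 1 w₃) := by
  rw [square_one_mid]
  exact InCone_thetaCyc_of_InCone_tri h₁ h₃ ht (le_refl 0) (by norm_num) (le_refl 0)

/-- The square with an unmarked first exit. -/
theorem InCone_square_one_left {w₂ w₃ : Vec6} (h₂ : InCone w₂) (h₃ : InCone w₃) (ht : InCone (thetaTri w₂ w₃)) :
    InCone (square 1 w₂ w₃) := by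
  rw [square_one_left]
  exact InCone_thetaCyc_of_InCone_tri h₂ h₃ ht (by norm_num) (le_refl 0) (le_refl 0)

/-- The square with an unmarked last exit. -/
theorem InCone_square_one_right {w₁ w₂ : Vec6} (h₁ : InCone w₁) (h₂ : InCone w₂) (ht : InCone (thetaTri w₁ w₂)) :
    InCone (square w₁ w₂ 1) := by
  rw [square_one_right]
  exact InCone_thetaCyc_of_InCone_tri h₁ h₂ ht (le_refl 0) (le_refl 0) (by norm_num)

end RelaxedTriangle

end PercRepro
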